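import Literature.AlgebraicGeometry.Surfaces.K3LatticeInvariantsSignatureProofs
import Literature.AlgebraicGeometry.Surfaces.K3LatticeInvariantsProofs
import Literature.Geometry.Symplectic.HirzebruchSignatureAlmostComplexFour
import Literature.Geometry.Symplectic.ComplexOrientationExists
import Literature.Geometry.Symplectic.FirstChernClassComplexFraming
import Literature.Geometry.Symplectic.AlmostComplexStructureOfComplex
import Literature.Geometry.Kaehler.HolomorphicSymplecticFraming
import HarnessLib

/-!
# `b₂ = 22` and index `−16` for a K3 surface from the Hirzebruch–Wu relation `c₁² = 2e + 3τ`
# (`c₁(X) = 0` proved; the signature theorem taken as the tree's named fact)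

Family `hodge`, layer `Literature/AlgebraicGeometry/Surfaces`. Theorems-only companion (D-0026: no
definition, no named fact) of `K3LatticeInvariants.lean`, for its named facts
`K3_finrank_complexBetti_two` (`b₂ = 22`) and
`K3_exists_orientation_signature_hodgeRiemann_ample` (index `−16`, Hodge–Riemann on `H^{2,0}`, an
ample class — the latter already reduced to the former,
`K3_exists_orientation_signature_hodgeRiemann_ample_of_finrank_complexBetti_two`).

**The printed proofs.** Huybrechts, *Lectures on K3 Surfaces*, Ch. 1: `b₂ = 22` from
`e(X) = c₂(X) = 24` (Noether's formula `2 = χ(𝒪) = (c₁² + c₂)/12`, §2.4 (2.6), §3.3 p. 24) and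
`b₁ = b₃ = 0`; the index `τ = (c₁² − 2c₂)/3 = −16` by the Thom–Hirzebruch index theorem (proof of
Prop. 3.5, p. 24; Milnor–Stasheff Thm. 19.4). The tree has neither Noether's formula nor
Hirzebruch–Riemann–Roch, but it NAMES the `4`-dimensional signature theorem in the almost complex
form `⟨c₁(TN, J)², [N]⟩ = 2 e(N) + 3 τ(N)` (McDuff–Salamon Rem. 4.1.10 (4.1.7): the named fact
`Literature.Geometry.Symplectic.hirzebruch_firstChernClass_sq_eq_almostComplex_four`), and it
PROVES the Hodge index theorem with sign for a K3 surface in the `b₂`-free form `τ = 6 − b₂`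
(`IsK3Surface.exists_orientation_hodgeRiemann_signature_eq`, `K3LatticeInvariantsSignatureProofs`)
and `e = 2 − 2b₁ + b₂` (`relEuler_complexPoints_surface`, `K3LatticeInvariantsProofs`). Reading the
two printed identities TOGETHER — `c₁ = 0` gives `0 = 2e + 3τ = 2(b₂ + 2) + 3(6 − b₂) = 22 − b₂`
(with `b₁ = 0`) — proves `b₂ = 22` (hence `e = 24`, `τ = −16`) WITHOUT Noether's formula. What this
file adds is the topological input `c₁(X) = 0` and the identification of the orientations:

1. `exists_complexFrame_of_isHolomorphicInCharts_of_pos`, `exists_finite_complexFrame_compl` — on a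
   compact complex surface with a nowhere-vanishing holomorphic `2`-form `η`, the framing
   `(s₁, i s₁, s₂, i s₂)` of `TX` off the finitely many critical points of a Morse function (the
   construction of `Geometry/Kaehler/HolomorphicSymplecticFraming.lean`, recorded with its complex
   structure: `s₂ = ξ` gradient-like, `s₁ = (Re η)⁻¹(df)`);
2. `firstChernClass_eq_zero_recharted` — hence, on the re-charted `X` (charts on `ℝ⁴`, almost
   complex structure `J v = L(i L⁻¹ v)` of `AlmostComplexStructureOfComplex.lean`),
   **`c₁(TX, J) = 0`** in `H²(X; ℤ)` (`firstChernClass_eq_zero_of_complexFrame_compl_finite`: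
   framed ⇒ trivial ⇒ `c₁` dies on `X ∖ F`, and `H²(X) ↪ H²(X ∖ F)`); for a K3 surface:
   `IsK3Surface.firstChernClass_eq_zero` (Huybrechts Ch. 1 Def. 1.1, `ω_X ≅ 𝒪_X`, whence the
   `c₁²(X) = 0` used in §2.4 (2.6) and in the proof of Prop. 3.5, p. 24);
3. `IsK3Surface.hodgeRiemann_comap_of_isComplexOrientationOf`,
   `IsK3Surface.signature_of_isComplexOrientationOf` — **the orientation induced by `J` is the
   Hodge–Riemann orientation**: for `μ` with `μ.IsComplexOrientationOf J`, `ω ∧ ω` is `J`-positive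
   for the Kähler form `ω` of a Kähler metric (`isPositiveTopForm_wedge_self_of_isCompatibleWith`),
   so `μ` pairs positively with `[ω ∧ ω]`, which pins it to the (ii)-orientation of
   `IsK3Surface.exists_orientation_hodgeRiemann_kaehler`; therefore `τ(X, μ) = 6 − b₂`;
4. `IsK3Surface.two_mul_relEuler_add_three_mul_eq_zero` — the Hirzebruch–Wu fact applied to
   `(X, J, μ)`: `2 e(S(ℂ)) + 3 (6 − b₂) = 0`;
5. `K3_finrank_complexBetti_two_of_hirzebruch_of_oddBetti`,
   `K3_relEuler_eq_of_hirzebruch_of_oddBetti`,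
   `K3_exists_orientation_signature_hodgeRiemann_ample_of_hirzebruch_of_oddBetti` — **`b₂ = 22`,
   `e = 24` and the index-`−16` fact from the two EXISTING named facts**
   `hirzebruch_firstChernClass_sq_eq_almostComplex_four` and `Huybrechts_K3_oddBetti_vanish`.

## References

* [Huybrechts2016K3] D. Huybrechts, *Lectures on K3 Surfaces*, CUP 2016, Ch. 1 Def. 1.1, §2.4 (2.6),
  §3.3 p. 24, Prop. 3.5 and its proof.
* [McDuffSalamon2017] D. McDuff, D. Salamon, *Introduction to Symplectic Topology*, 3rd ed., OUP
  2017, Rem. 4.1.10 (4.1.7), Rem. 4.1.12, §4.1.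
* [MilnorStasheff1974] J. Milnor, J. Stasheff, *Characteristic Classes* (1974), §2 Thm. 2.2, §14,
  §19 Thm. 19.4.
* [VoisinHodgeI2002] C. Voisin, *Hodge Theory and Complex Algebraic Geometry I* (2002), §3.1.1
  Lemma 3.3, §3.1.3 Lemma 3.8, §6.3.2 Thm. 6.32–6.33.
-/

noncomputable section

open scoped Manifold ContDiff Topology
open CategoryTheory Module Bundle Set Function
open Literature.AlgebraicTopology.SingularHomology
open Literature.Topology.FourManifolds
open Literature.Geometry.Kaehler (MForm IsSmoothForm IsClosedForm closedSmoothForms deRhamCohomology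
  IsHolomorphicInCharts tangentJ)
open Literature.NumberTheory.Transcendental
open Literature.Geometry.Symplectic

namespace Literature.AlgebraicGeometry.Surfaces

/-! ### Part 1: the complex frame of a holomorphic symplectic surface off a finite set -/

section ComplexFrame

open Literature.Geometry.Kaehler

variable {E : Type*} [NormedAddCommGroup E] [NormedSpace ℂ E] [FiniteDimensional ℂ E]
  {M : Type*} [TopologicalSpace M] [ChartedSpace E M] [IsManifold 𝓘(ℝ, E) ∞ M]

/-- **The complex frame `(s₁, i s₁, s₂, i s₂)` off the bad set of `(f, ξ)`.** On a real-smooth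
manifold charted on a complex plane `E`, with `η` a nowhere-vanishing `2`-form holomorphic in
charts, `f` smooth, `ξ` a continuous vector field and `df(ξ) > 0` off `F`: the two continuous vector
fields `s₁ = (Re η)⁻¹(df)` and `s₂ = ξ` satisfy: `(s₁, i s₁, s₂, i s₂)` is linearly independent over
`ℝ` at every point off `F` (`Re η(s₁, ξ) = df(ξ) > 0` forces `η(s₁, ξ) ≠ 0`). This is the frame of
`hasTangentFramingAlong_of_isHolomorphicInCharts_of_pos`, recorded together with its complex
structure. [cite: MilnorStasheff1974, §2 Thm. 2.2] [cite: Huybrechts2016K3, Ch. 1 §3.3 p. 24] -/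
theorem exists_complexFrame_of_isHolomorphicInCharts_of_pos (h2 : finrank ℂ E = 2)
    {η : MForm 𝓘(ℝ, E) M ℂ 2} (hη : IsHolomorphicInCharts η) (hη0 : ∀ x, η x ≠ 0)
    {f : M → ℝ} (hf : ContMDiff 𝓘(ℝ, E) 𝓘(ℝ, ℝ) ∞ f) {ξ : M → E}
    (hξ : Continuous (fun x => (TotalSpace.mk' E x (ξ x) : TangentBundle 𝓘(ℝ, E) M)))
    {F : Set M} (hpos : ∀ x, x ∉ F → 0 < mlineDeriv 𝓘(ℝ, E) f x (ξ x)) :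
    ∃ s : Fin 2 → M → E,
      (∀ i, Continuous (fun x => (TotalSpace.mk' E x (s i x) : TangentBundle 𝓘(ℝ, E) M))) ∧
      ∀ x, x ∉ F → LinearIndependent ℝ ![s 0 x, Complex.I • s 0 x, s 1 x, Complex.I • s 1 x] := by
  -- pointwise structure of `η`
  have hg : ∀ x, ∃ g : E [⋀^Fin 2]→L[ℂ] ℂ, g ≠ 0 ∧ η x = g.restrictScalars ℝ := fun x => by
    obtain ⟨g, hg⟩ := hη.exists_apply_eq_restrictScalars x
    refine ⟨g, fun h0 => hη0 x ?_, hg⟩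
    rw [hg]
    ext v
    show g v = 0
    rw [h0]
    rfl
  have hinv : ∀ x, (rePairing (E := E) (η x)).IsInvertible := fun x => by
    obtain ⟨g, hg0, hgx⟩ := hg x
    rw [hgx]
    exact isInvertible_rePairing_restrictScalars h2 hg0
  have hsm : ∀ x, η.SmoothAt x := fun x => hη.isSmoothForm x
  haveI : CompleteSpace E := FiniteDimensional.complete ℝ E
  -- the section `s₁ = (Re η)⁻¹ (df)`
  set l₁ : M → E →L[ℝ] ℝ := fun x =>
    fderiv ℝ (f ∘ (extChartAt 𝓘(ℝ, E) x).symm) (extChartAt 𝓘(ℝ, E) x x) with hl₁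
  set s₁ : M → E := fun x => (rePairing (E := E) (η x)).inverse (l₁ x) with hs₁
  have hc₁ : Continuous (fun x => (TotalSpace.mk' E x (s₁ x) : TangentBundle 𝓘(ℝ, E) M)) :=
    continuous_iff_continuousAt.2 fun x₀ => continuousAt_rePairing_inverse_section (hsm x₀) hinv
      (continuousAt_fderiv_comp_tangentCoordChange hf x₀)
  refine ⟨![s₁, ξ], fun i => ?_, fun p hp => ?_⟩
  · fin_cases i
    · simpa using hc₁
    · simpa using hξ
  · obtain ⟨g, hg0, hgx⟩ := hg p
    have hlp : 0 < l₁ p (ξ p) := by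
      rw [hl₁, ← mlineDeriv_eq_fderiv_comp_extChartAt_symm (hf.mdifferentiableAt (by simp))]
      exact hpos p hp
    have ha : rePairing (E := E) (η p) (s₁ p) = l₁ p := (hinv p).self_apply_inverse _
    have hab : g ![s₁ p, ξ p] ≠ 0 := by
      intro h0
      have h1 : rePairing (E := E) (η p) (s₁ p) (ξ p) = 0 := by
        rw [hgx, rePairing_apply, ContinuousAlternatingMap.coe_restrictScalars, h0, Complex.zero_re]
      rw [ha] at h1
      exact hlp.ne' h1
    have hLI := linearIndependent_of_apply_pair_ne_zero g hab
    simpa using hLI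

variable [T2Space M] [CompactSpace M] [SecondCountableTopology M]

/-- **A compact complex surface with a nowhere-vanishing holomorphic `2`-form is complex-framed
off a finite set**: there are a finite `F ⊆ M` and two continuous vector fields `s₁, s₂` with
`(s₁, i s₁, s₂, i s₂)` linearly independent off `F` (the frame of
`exists_complexFrame_of_isHolomorphicInCharts_of_pos` for a Morse function and a gradient-like
vector field, `exists_contMDiff_vectorField_pos_off_finite`). [cite: Huybrechts2016K3, Ch. 1 §3.3 p. 24]
[cite: MilnorStasheff1974, §2 Thm. 2.2] -/
theorem exists_finite_complexFrame_compl (h2 : finrank ℂ E = 2)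
    {η : MForm 𝓘(ℝ, E) M ℂ 2} (hη : IsHolomorphicInCharts η) (hη0 : ∀ x, η x ≠ 0) :
    ∃ (F : Set M) (s : Fin 2 → M → E), F.Finite ∧
      (∀ i, Continuous (fun x => (TotalSpace.mk' E x (s i x) : TangentBundle 𝓘(ℝ, E) M))) ∧
      ∀ x, x ∉ F → LinearIndependent ℝ ![s 0 x, Complex.I • s 0 x, s 1 x, Complex.I • s 1 x] := by
  obtain ⟨f, F, ξ, hf, hF, hξ, hpos⟩ :=
    exists_contMDiff_vectorField_pos_off_finite (E := E) (M := M)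
  obtain ⟨s, hsc, hli⟩ := exists_complexFrame_of_isHolomorphicInCharts_of_pos h2 hη hη0 hf hξ hpos
  exact ⟨F, s, hF, hsc, hli⟩

end ComplexFrame

/-! ### Part 2: `c₁(TX, J) = 0` for the re-charted holomorphic symplectic surface -/

section FirstChernClass

open Literature.Geometry.Kaehler

variable {E : Type} [NormedAddCommGroup E] [NormedSpace ℂ E] [FiniteDimensional ℂ E]
  {M : Type} [TopologicalSpace M] [ChartedSpace E M] [IsManifold 𝓘(ℝ, E) ∞ M]
  [T2Space M] [CompactSpace M] [SecondCountableTopology M]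

/-- The interleaving `Fin 2 ⊕ Fin 2 → Fin 4`, `(inl i ↦ 2i, inr i ↦ 2i + 1)`, under which
`Sum.elim a b` becomes `![a 0, b 0, a 1, b 1]`. [folklore] -/
theorem vec4_comp_interleave {α : Type*} (a b : Fin 2 → α) :
    (![a 0, b 0, a 1, b 1] ∘ (Sum.elim (fun i : Fin 2 ↦ (⟨2 * i.val, by omega⟩ : Fin 4))
      (fun i : Fin 2 ↦ (⟨2 * i.val + 1, by omega⟩ : Fin 4)))) = Sum.elim a b := by
  funext j
  rcases j with i | i <;> fin_cases i <;> rfl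

/-- **`c₁(TX, J) = 0` for a compact complex surface with a nowhere-vanishing holomorphic
`2`-form, re-charted on `ℝ⁴`** (the `c₁(X) = 0` of Huybrechts Ch. 1 — Def. 1.1, `ω_X ≅ 𝒪_X`; used as
`c₁²(X) = 0` in §2.4 (2.6) and in the proof of Prop. 3.5, p. 24 — in the tree's
topological Chern classes of the almost complex structure `J v = L(i L⁻¹ v)` of `Recharted M L`):
push the complex frame of `exists_finite_complexFrame_compl` forward along the identity
`M → Recharted M L` (differential `L`); it is a frame `(t₁, t₂, J t₁, J t₂)` of the tangent spaces
off a finite set, so `firstChernClass_eq_zero_of_complexFrame_compl_finite` applies.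
[cite: Huybrechts2016K3, Ch. 1 Def. 1.1, §2.4 (2.6) and Prop. 3.5, proof (p. 24)] [cite: MilnorStasheff1974, §2 Thm. 2.2 and §14] -/
theorem firstChernClass_eq_zero_recharted (h2 : finrank ℂ E = 2)
    {η : MForm 𝓘(ℝ, E) M ℂ 2} (hη : IsHolomorphicInCharts η) (hη0 : ∀ x, η x ≠ 0)
    (L : E ≃L[ℝ] EuclideanSpace ℝ (Fin 4)) {n : WithTop ℕ∞}
    (J : AlmostComplexStructure (𝓡 4) n (Recharted M L))
    (hJ : ∀ (x : Recharted M L) (v : TangentSpace (𝓡 4) x), J x v = L (Complex.I • (L.symm v : E))) :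
    J.firstChernClass = 0 := by
  obtain ⟨F, s, hF, hsc, hli⟩ := exists_finite_complexFrame_compl h2 hη hη0
  have h4 : finrank ℝ E = 4 := by rw [finrank_real_of_complex, h2]
  -- the pushed-forward frame on `N = Recharted M L`, along `N ∖ F ↪ N`
  let t : Fin 2 → ((F : Set (Recharted M L))ᶜ : Set (Recharted M L)) → EuclideanSpace ℝ (Fin 4) :=
    fun i p ↦ L (s i ((Recharted.of L).symm p))
  have he : ContMDiff 𝓘(ℝ, E) (𝓡 4) 1 (Recharted.of L : M → Recharted M L) :=
    (Recharted.contMDiff_of L).of_le (by exact_mod_cast le_top)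
  have htc : ∀ i, Continuous fun p : ((F : Set (Recharted M L))ᶜ : Set (Recharted M L)) ↦
      (⟨(p : Recharted M L), t i p⟩ : TangentBundle (𝓡 4) (Recharted M L)) := by
    intro i
    have hT : Continuous (tangentMap 𝓘(ℝ, E) (𝓡 4) (Recharted.of L : M → Recharted M L)) :=
      he.continuous_tangentMap le_rfl
    have hcomp : Continuous fun p : ((F : Set (Recharted M L))ᶜ : Set (Recharted M L)) ↦
        tangentMap 𝓘(ℝ, E) (𝓡 4) (Recharted.of L)
          (TotalSpace.mk' E ((Recharted.of L).symm p) (s i ((Recharted.of L).symm p)) :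
            TangentBundle 𝓘(ℝ, E) M) :=
      hT.comp ((hsc i).comp ((Recharted.ofHomeomorph L).symm.continuous.comp
        (continuous_subtype_val :
          Continuous (Subtype.val : ((F : Set (Recharted M L))ᶜ : Set (Recharted M L)) → _))))
    refine hcomp.congr fun p ↦ ?_
    simp only [tangentMap, Recharted.mfderiv_of, TotalSpace.mk']
    rfl
  have htb : ∀ p : ((F : Set (Recharted M L))ᶜ : Set (Recharted M L)),
      LinearIndependent ℝ (Sum.elim (fun i ↦ t i p) (fun i ↦ J (p : Recharted M L) (t i p))) ∧
      ⊤ ≤ Submodule.span ℝ (range (Sum.elim (fun i ↦ t i p) (fun i ↦ J (p : Recharted M L) (t i p)))) := by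
    intro p
    set x : M := (Recharted.of L).symm p with hx
    have hxF : x ∉ F := p.2
    -- the frame on `N` is `L` applied to `(s₁, s₂, i s₁, i s₂)`
    have hfam : Sum.elim (fun i ↦ t i p) (fun i ↦ J (p : Recharted M L) (t i p)) =
        (L : E → EuclideanSpace ℝ (Fin 4)) ∘ Sum.elim (fun i ↦ s i x) (fun i ↦ Complex.I • s i x) := by
      funext j
      rcases j with i | i
      · rfl
      · simp [t, hJ, hx]
    have hli4 : LinearIndependent ℝ (Sum.elim (fun i ↦ s i x) (fun i ↦ Complex.I • s i x)) := by
      rw [← vec4_comp_interleave]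
      exact (hli x hxF).comp _ (by decide)
    have hliL : LinearIndependent ℝ
        ((L : E → EuclideanSpace ℝ (Fin 4)) ∘ Sum.elim (fun i ↦ s i x) (fun i ↦ Complex.I • s i x)) :=
      hli4.map' (L : E →L[ℝ] EuclideanSpace ℝ (Fin 4)).toLinearMap
        (LinearMap.ker_eq_bot.2 L.injective)
    rw [hfam]
    refine ⟨hliL, ?_⟩
    rw [hliL.span_eq_top_of_card_eq_finrank' (by simp)]
  exact AlmostComplexStructure.firstChernClass_eq_zero_of_complexFrame_compl_finite (d := 4)
    (by norm_num) J (show (F : Set (Recharted M L)).Finite from hF) t htc htb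

end FirstChernClass

/-! ### Part 3: K3 surfaces — `c₁ = 0`, and the `J`-orientation is the Hodge–Riemann orientation -/

section K3

variable {S : Motives.SchemeOver ℂ}

/-- **`c₁(X) = 0` for a K3 surface** (Huybrechts Ch. 1 Def. 1.1: the canonical bundle is trivial,
so `c₁(X) = −c₁(ω_X) = 0`, the input `c₁²(X) = 0` of §2.4 (2.6) and of the proof of Prop. 3.5,
p. 24), for the topological first Chern class of the almost complex structure
`J v = L(i L⁻¹ v)` on the re-charted Hodge model `X^an` of `S` (`firstChernClass_eq_zero_recharted`
with the holomorphic symplectic form of `IsK3Surface`). [cite: Huybrechts2016K3, Ch. 1 Def. 1.1 and Prop. 3.5, proof (p. 24)] -/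
theorem IsK3Surface.firstChernClass_eq_zero (hS : IsK3Surface S) (A : HodgeTheory.HodgeModel 2 S)
    {η : MForm 𝓘(ℝ, A.model) A.carrier ℂ 2} (hη : IsHolomorphicInCharts η) (hη0 : ∀ x, η x ≠ 0)
    (L : A.model ≃L[ℝ] EuclideanSpace ℝ (Fin 4)) {n : WithTop ℕ∞}
    (J : AlmostComplexStructure (𝓡 4) n (Recharted A.carrier L))
    (hJ : ∀ (x : Recharted A.carrier L) (v : TangentSpace (𝓡 4) x),
      J x v = L (Complex.I • (L.symm v : A.model))) :
    J.firstChernClass = 0 := by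
  haveI : CompactSpace A.carrier := A.compactSpace_carrier hS.1
  haveI : SecondCountableTopology A.carrier :=
    ChartedSpace.secondCountable_of_sigmaCompact A.model A.carrier
  exact firstChernClass_eq_zero_recharted A.isAnalytification.finrank_eq hη hη0 L J hJ

set_option maxHeartbeats 800000 in -- orientation bookkeeping across three carriers
/-- **The orientation induced by `J` is the Hodge–Riemann orientation.** For a K3 surface `S`, a
Hodge model `A` with the holomorphic symplectic form `η`, the re-charted `X = Recharted A.carrier L`
with `J v = L(i L⁻¹ v)`, and a homological orientation `μ` of `X` induced by `J`
(`μ.IsComplexOrientationOf J`, McDuff–Salamon Rem. 4.1.12), the orientation of `S(ℂ)` obtained by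
transport along `S(ℂ) ≅ X^an = X` satisfies the Hodge–Riemann positivity (ii) on `H^{2,0}`:
`σ̄ ∪ σ = c • (g ⊗ 1)`, `re c > 0` (Huybrechts Ch. 6 Prop. 1.2 (ii)). Proof: for a Kähler metric
with Kähler form `ω`, the pulled-back `ω` tames `J` and is `J`-invariant (`ω(v, Jv) = g(v, v) > 0`,
`ω(J·, J·) = ω`, Voisin I Lemma 3.3), so `ω ∧ ω` is `J`-positive
(`isPositiveTopForm_wedge_self_of_isCompatibleWith`) and `μ` pairs positively with `[ω ∧ ω]`
(Lemma 3.8: `ω²/2` is the volume form of the complex orientation); transported to `S(ℂ)`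
(naturality of the integration isomorphism across model spaces,
`integrationDeRhamIsoFamily_map_of_contMDiff`), this is the Kähler positivity (b) which pins down
the (ii)-orientation of `IsK3Surface.exists_orientation_hodgeRiemann_kaehler` among the two
orientations of the connected closed `S(ℂ)`.
[cite: McDuffSalamon2017, Rem. 4.1.12 and §4.1] [cite: VoisinHodgeI2002, §3.1.1 Lemma 3.3 and §3.1.3 Lemma 3.8]
[cite: Huybrechts2016K3, Ch. 6 Prop. 1.2 (ii)] -/
theorem IsK3Surface.hodgeRiemann_comap_of_isComplexOrientationOf (hS : IsK3Surface S)
    (A : HodgeTheory.HodgeModel 2 S) {η : MForm 𝓘(ℝ, A.model) A.carrier ℂ 2}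
    (hη : IsHolomorphicInCharts η) (hη0 : ∀ x, η x ≠ 0)
    (L : A.model ≃L[ℝ] EuclideanSpace ℝ (Fin 4)) {n : WithTop ℕ∞}
    (J : AlmostComplexStructure (𝓡 4) n (Recharted A.carrier L))
    (hJ : ∀ (x : Recharted A.carrier L) (v : TangentSpace (𝓡 4) x),
      J x v = L (Complex.I • (L.symm v : A.model)))
    [CompactSpace (Recharted A.carrier L)]
    (μN : HomologicalOrientation ℤ (Recharted A.carrier L) 4) (hμN : μN.IsComplexOrientationOf J) :
    ∀ σ : HodgeTheory.complexBetti S (2 * 1), HodgeTheory.IsOfHodgeType 2 S (2 * 1) 2 0 σ →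
      σ ≠ 0 → ∀ g : singularCohomology ℤ ℤ (Motives.ComplexPoints S) (2 * 2),
        kroneckerPairing ℤ ℤ (Motives.ComplexPoints S) (2 * 2) g
          ((μN.comap (A.isAnalytification.homeomorph.symm.trans (Recharted.ofHomeomorph L)) :
            HomologicalOrientation ℤ (Motives.ComplexPoints S) (2 * 2))).fundamentalClass = 1 →
          ∃ c : ℂ, 0 < c.re ∧
            cupProduct (rfl : 2 * 1 + 2 * 1 = 2 * 2)
              (HodgeTheory.conjClass (Motives.ComplexPoints S) (2 * 1) σ) σ =
                c • singularCohomology.ringChange (algebraMap ℤ ℂ) (Motives.ComplexPoints S)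
                  (2 * 2) g := by
  classical
  have hX := hS.isSmoothProjective
  letI := hX.chartedSpace
  haveI := Motives.ComplexPoints.compactSpace_of_isSmoothProjective hX
  haveI := Motives.ComplexPoints.t2Space_of_isSmoothProjective hX
  haveI := HodgeTheory.connectedSpace_complexPoints hX
  have hφ := A.isAnalytification
  haveI : CompactSpace A.carrier := A.compactSpace_carrier hX
  haveI : Nonempty A.carrier := ⟨hφ.homeomorph.symm (Classical.arbitrary _)⟩
  haveI : ConnectedSpace A.carrier :=
    hφ.homeomorph.symm.surjective.connectedSpace hφ.homeomorph.symm.continuous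
  haveI : SecondCountableTopology A.carrier :=
    ChartedSpace.secondCountable_of_sigmaCompact A.model A.carrier
  haveI : LocallyCompactSpace A.carrier := ChartedSpace.locallyCompactSpace A.model A.carrier
  haveI : LocallyCompactSpace (Recharted A.carrier L) :=
    ChartedSpace.locallyCompactSpace (EuclideanSpace ℝ (Fin 4)) (Recharted A.carrier L)
  have hfin : Module.finrank ℂ A.model = 2 := hφ.finrank_eq
  -- `A.carrier` is compact Kähler: a smooth Kähler metric `gK`, its Kähler form `ωK`
  haveI : AlgebraicGeometry.SmoothOfRelativeDimension 2 S.hom := hX.smoothOfRelativeDimension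
  obtain ⟨N', ι, hι⟩ := hX.isProjectiveOver
  haveI : Literature.Geometry.Kaehler.IsKaehlerManifold A.model A.carrier :=
    Motives.isKaehlerManifold_of_isAnalytification_of_isClosedImmersion_holds (X := S) (d := 2)
      (E := A.model) (M := A.carrier) (φ := A.toComplexPoints) ι hφ
  haveI : WedgeFacts 𝓘(ℝ, A.model) A.carrier ℝ :=
    wedgeFacts_of_assoc 𝓘(ℝ, A.model) A.carrier ℝ (ContinuousAlternatingMap.WedgeAssoc_holds ℝ A.model ℝ)
  obtain ⟨gK, hgK⟩ := Literature.Geometry.Kaehler.IsKaehlerManifold.exists_isKaehler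
    (E := A.model) (M := A.carrier)
  have hH := hgK.isHermitian
  set ωK := gK.toRiemannianMetric.kaehlerForm with hωKdef
  have hωs : IsSmoothForm ωK :=
    Literature.Geometry.Kaehler.isSmoothForm_kaehlerForm_of_isManifold_complex_holds
      (E := A.model) (M := A.carrier) gK
  have hωc : ωK ∈ closedSmoothForms 𝓘(ℝ, A.model) A.carrier ℝ 2 := ⟨hωs, hgK.isClosedForm_kaehlerForm⟩
  have hωω : ωK.wedge ωK ∈ closedSmoothForms 𝓘(ℝ, A.model) A.carrier ℝ (2 + 2) :=
    wedge_mem_closedSmoothForms hωc hωc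
  -- the identity `f : N → A.carrier`, smooth with differential `L⁻¹`
  set f : Recharted A.carrier L → A.carrier :=
    ((Recharted.of L).symm : Recharted A.carrier L → A.carrier) with hfdef
  have hf : ContMDiff (𝓡 4) 𝓘(ℝ, A.model) ∞ f := Recharted.contMDiff_of_symm L
  have hmf : ∀ y, mfderiv (𝓡 4) 𝓘(ℝ, A.model) f y = (L.symm : EuclideanSpace ℝ (Fin 4) →L[ℝ] A.model) :=
    fun y ↦ Literature.Geometry.Kaehler.mfderiv_recharted_of_symm L y
  -- the pulled-back Kähler form tames `J` and is `J`-invariant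
  set sN : MForm (𝓡 4) (Recharted A.carrier L) ℝ 2 := ωK.pullback (𝓡 4) f with hsNdef
  have hsN : ∀ (y : Recharted A.carrier L) (v w : EuclideanSpace ℝ (Fin 4)),
      sN y ![v, w] = ωK (f y) ![L.symm v, L.symm w] := by
    intro y v w
    rw [hsNdef, MForm.pullback_apply, hmf]
    congr 1
    funext i
    fin_cases i <;> rfl
  have hJsymm : ∀ (y : Recharted A.carrier L) (v : EuclideanSpace ℝ (Fin 4)),
      L.symm (J y v) = tangentJ A.model (f y) (L.symm v) := by
    intro y v
    rw [hJ, ContinuousLinearEquiv.symm_apply_apply, Literature.Geometry.Kaehler.tangentJ_apply]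
  have hcompat : J.IsCompatibleWith sN := by
    refine ⟨fun y v hv ↦ ?_, fun y v w ↦ ?_⟩
    · rw [hsN, hJsymm]
      exact HodgeTheory.kaehlerForm_self_tangentJ_pos gK.toRiemannianMetric hH (f y) (L.symm v)
        (fun h0 ↦ hv (by rw [← L.apply_symm_apply v, h0]; exact map_zero L))
    · rw [hsN, hsN, hJsymm, hJsymm]
      exact hH.kaehlerForm_tangentJ_tangentJ (f y) (L.symm v) (L.symm w)
  -- `ω ∧ ω`, pulled back, is a `J`-positive closed smooth top form
  set v4 : MForm (𝓡 4) (Recharted A.carrier L) ℝ 4 := (sN.wedge sN).castDeg two_add_two_eq_four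
    with hv4def
  have hJpos : J.IsPositiveTopForm v4 := isPositiveTopForm_wedge_self_of_isCompatibleWith hcompat
  have hpb : (ωK.wedge ωK).pullback (𝓡 4) f ∈
      closedSmoothForms (𝓡 4) (Recharted A.carrier L) ℝ (2 + 2) :=
    pullback_mem_closedSmoothForms hf hωω
  have hwedge : sN.wedge sN = (ωK.wedge ωK).pullback (𝓡 4) f := by
    rw [hsNdef, MForm.pullback_wedge]
  have hv4 : v4 ∈ closedSmoothForms (𝓡 4) (Recharted A.carrier L) ℝ 4 := by
    rw [hv4def, hwedge]
    exact castDeg_mem_closedSmoothForms _ hpb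
  have hper : 0 < periodFunctional v4 hv4.1 hv4.2 μN.fundamentalClass :=
    hμN.periodFunctional_fundamentalClass_pos hv4.1 hv4.2 hJpos
  -- the same positivity read on `A.carrier`: `⟨e_A[ω ∧ ω], f_*([N] ⊗ 1)⟩ > 0`
  have hcls : (⟨v4, hv4⟩ : closedSmoothForms (𝓡 4) (Recharted A.carrier L) ℝ 4) =
      ⟨(ωK.wedge ωK).pullback (𝓡 4) f, hpb⟩ := by
    apply Subtype.ext
    funext y
    ext w
    change v4 y w = ((ωK.wedge ωK).pullback (𝓡 4) f) y w
    rw [hv4def, MForm.castDeg_apply, hwedge]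
    exact congrArg (((ωK.wedge ωK).pullback (𝓡 4) f) y) (funext fun i ↦ congrArg w (Fin.ext rfl))
  have hposA : 0 < kroneckerPairing ℝ ℝ A.carrier 4
      (integrationDeRhamIsoFamily A.model A.carrier 4 (deRhamCohomology.mk ⟨ωK.wedge ωK, hωω⟩))
      (singularHomology.map ℝ ℝ ⟨f, hf.continuous⟩ 4
        (singularHomology.coeffChange (Recharted A.carrier L)
          (algebraMap ℤ ℝ : ℤ →+* ℝ).toAddMonoidHom 4 μN.fundamentalClass)) := by
    rw [← kroneckerPairing_map, ← Literature.Geometry.Manifold.integrationDeRhamIsoFamily_map_of_contMDiff hf 4,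
      deRhamCohomology.map_mk]
    rw [periodFunctional_apply, realClassOfClosedForm_eq, intCastAddHom_real_eq_algebraMap] at hper
    convert hper using 3
    exact congrArg (fun c ↦ integrationDeRhamIsoFamily (EuclideanSpace ℝ (Fin 4))
      (Recharted A.carrier L) 4 (deRhamCohomology.mk c)) hcls.symm
  -- transport to `S(ℂ)` along `ψ : S(ℂ) ≃ₜ N`
  set φA : C(A.carrier, Motives.ComplexPoints S) :=
    ⟨A.toComplexPoints, hφ.isHomeomorph.continuous⟩ with hφA
  let ψ : Motives.ComplexPoints S ≃ₜ Recharted A.carrier L :=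
    hφ.homeomorph.symm.trans (Recharted.ofHomeomorph L)
  set μS : HomologicalOrientation ℤ (Motives.ComplexPoints S) (2 * 2) :=
    μN.comap (A.isAnalytification.homeomorph.symm.trans (Recharted.ofHomeomorph L)) with hμSdef
  have hψ : (ψ.symm : C(Recharted A.carrier L, Motives.ComplexPoints S)) =
      φA.comp ⟨f, hf.continuous⟩ := by
    ext x; rfl
  have hfc : μS.fundamentalClass =
      singularHomology.map ℤ ℤ (ψ.symm : C(Recharted A.carrier L, Motives.ComplexPoints S)) (2 * 2)
        μN.fundamentalClass := by
    rw [hμSdef, HomologicalOrientation.fundamentalClass_comap_holds (R := ℤ)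
      (X := Recharted A.carrier L) (Y := Motives.ComplexPoints S) (2 * 2) μN ψ,
      singularHomology.mapIso_inv]
  have hKS : ∀ y : singularCohomology ℝ ℝ (Motives.ComplexPoints S) (2 * 2),
      singularCohomology.map ℝ ℝ φA (2 * 2) y =
        integrationDeRhamIsoFamily A.model A.carrier (2 * 2) (deRhamCohomology.mk ⟨ωK.wedge ωK, hωω⟩) →
      0 < kroneckerPairing ℝ ℝ (Motives.ComplexPoints S) (2 * 2) y
        (singularHomology.coeffChange (Motives.ComplexPoints S)
          (algebraMap ℤ ℝ : ℤ →+* ℝ).toAddMonoidHom (2 * 2) μS.fundamentalClass) := by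
    intro y hy
    rw [hfc, singularHomology.coeffChange_map, ← kroneckerPairing_map, hψ,
      singularCohomology.map_comp, ModuleCat.comp_apply, hy, kroneckerPairing_map]
    exact hposA
  -- the (ii)-orientation `μ₁` of `exists_orientation_hodgeRiemann_kaehler` is `μS`
  have hsurj : ∀ k, Function.Surjective (singularCohomology.map ℝ ℝ φA k) := fun k ↦
    (singularCohomology.mapIso ℝ ℝ hφ.homeomorph k).toLinearEquiv.surjective
  obtain ⟨yω, hyω⟩ := hsurj (2 * 2)
    (integrationDeRhamIsoFamily A.model A.carrier (2 * 2) (deRhamCohomology.mk ⟨ωK.wedge ωK, hωω⟩))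
  obtain ⟨μ₁, hHR₁, hK₁⟩ := hS.exists_orientation_hodgeRiemann_kaehler A hη hη0
    (integrationDeRhamIsoFamily A.model) integrationDeRhamIsoFamily_isNatural
    integrationDeRhamIsoFamily_isMultiplicative
  have hμ₁ : μ₁ = μS := by
    rcases HomologicalOrientation.eq_or_eq_neg_of_connected_holds (Motives.ComplexPoints S) μ₁ μS
      with h | h
    · exact h
    · exfalso
      have h₁ := hK₁ gK hgK hωω yω hyω
      have h₂ := hKS yω hyω
      rw [h, HomologicalOrientation.fundamentalClass_neg_holds (R := ℤ)
        (X := Motives.ComplexPoints S) (2 * 2) μS,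
        map_neg (singularHomology.coeffChange (Motives.ComplexPoints S)
          (algebraMap ℤ ℝ : ℤ →+* ℝ).toAddMonoidHom (2 * 2)),
        map_neg (kroneckerPairing ℝ ℝ (Motives.ComplexPoints S) (2 * 2) yω)] at h₁
      linarith
  have hHRS := hHR₁
  rw [hμ₁] at hHRS
  exact hHRS

/-- **The signature of the orientation induced by `J` is `6 − b₂`.** With the notation of
`IsK3Surface.hodgeRiemann_comap_of_isComplexOrientationOf`: `τ(X, μ) = 6 − b₂(S)` for every
homological orientation `μ` of the re-charted Hodge model `X` induced by `J` — the transported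
orientation is THE (ii)-orientation of `S(ℂ)` (`IsK3Surface.orientation_unique_of_hodgeRiemann_twoZero`),
whose signature is `6 − b₂` by the Hodge index theorem with sign
(`IsK3Surface.exists_orientation_hodgeRiemann_signature_eq`: `(b⁺, b⁻) = (3, b₂ − 3)`, Voisin I
Thm. 6.33), and the signature is a homeomorphism invariant (`signature_intersectionForm_comap_holds`).
[cite: VoisinHodgeI2002, §6.3.2 Thm. 6.32 and Thm. 6.33] [cite: Huybrechts2016K3, Ch. 1 Prop. 3.5, proof (p. 24)]
[cite: McDuffSalamon2017, Rem. 4.1.12] -/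
theorem IsK3Surface.signature_of_isComplexOrientationOf (hS : IsK3Surface S)
    (A : HodgeTheory.HodgeModel 2 S) {η : MForm 𝓘(ℝ, A.model) A.carrier ℂ 2}
    (hη : IsHolomorphicInCharts η) (hη0 : ∀ x, η x ≠ 0)
    (L : A.model ≃L[ℝ] EuclideanSpace ℝ (Fin 4)) {n : WithTop ℕ∞}
    (J : AlmostComplexStructure (𝓡 4) n (Recharted A.carrier L))
    (hJ : ∀ (x : Recharted A.carrier L) (v : TangentSpace (𝓡 4) x),
      J x v = L (Complex.I • (L.symm v : A.model)))
    [CompactSpace (Recharted A.carrier L)]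
    (μN : HomologicalOrientation ℤ (Recharted A.carrier L) 4) (hμN : μN.IsComplexOrientationOf J) :
    (intersectionForm two_add_two_eq_four μN).signature =
      6 - (Module.finrank ℂ (HodgeTheory.complexBetti S (2 * 1)) : ℤ) := by
  have hX := hS.isSmoothProjective
  letI := hX.chartedSpace
  haveI := Motives.ComplexPoints.compactSpace_of_isSmoothProjective hX
  haveI := Motives.ComplexPoints.t2Space_of_isSmoothProjective hX
  have hHRS := hS.hodgeRiemann_comap_of_isComplexOrientationOf A hη hη0 L J hJ μN hμN
  -- the Hodge index theorem with sign: the (ii)-orientation has signature `6 − b₂`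
  obtain ⟨μ₀, hHR₀, hsig₀⟩ := hS.exists_orientation_hodgeRiemann_signature_eq A hη hη0
    (integrationDeRhamIsoFamily A.model) integrationDeRhamIsoFamily_isNatural
    integrationDeRhamIsoFamily_isMultiplicative
  have hμ₀ := hS.orientation_unique_of_hodgeRiemann_twoZero hHRS hHR₀
  -- homeomorphism invariance of the signature
  have hcomap := signature_intersectionForm_comap_holds two_add_two_eq_four μN
    (A.isAnalytification.homeomorph.symm.trans (Recharted.ofHomeomorph L))
  rw [← hcomap]
  change (intersectionForm (rfl : 2 * 1 + 2 * 1 = 2 * 2)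
    ((μN.comap (A.isAnalytification.homeomorph.symm.trans (Recharted.ofHomeomorph L)) :
      HomologicalOrientation ℤ (Motives.ComplexPoints S) (2 * 2)))).signature = _
  rw [hμ₀]
  exact hsig₀

/-- **The Hirzebruch–Wu relation for a K3 surface: `2 e(S(ℂ)) + 3 (6 − b₂(S)) = 0`**, granted the
named fact `hirzebruch_firstChernClass_sq_eq_almostComplex_four` (`⟨c₁², [N]⟩ = 2e + 3τ` for closed
almost complex `4`-manifolds with the `J`-orientation; McDuff–Salamon Rem. 4.1.10 (4.1.7), from
Hirzebruch's signature theorem): applied to the re-charted Hodge model with its almost complex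
structure and induced orientation, where `c₁ = 0` (`IsK3Surface.firstChernClass_eq_zero`),
`τ = 6 − b₂` (`IsK3Surface.signature_of_isComplexOrientationOf`) and `e(X^an) = e(S(ℂ))`
(`relEuler_hodgeModel_carrier`). This is Huybrechts' "`τ = (c₁² − 2c₂)/3`" (proof of Prop. 3.5)
combined with "`e = c₂`" (§3.3 p. 24). [cite: Huybrechts2016K3, Ch. 1 Prop. 3.5, proof (p. 24) and §3.3 p. 24]
[cite: McDuffSalamon2017, Rem. 4.1.10 (4.1.7)] [cite: MilnorStasheff1974, §19 Thm. 19.4] -/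
theorem IsK3Surface.two_mul_relEuler_add_three_mul_eq_zero
    (hHW : hirzebruch_firstChernClass_sq_eq_almostComplex_four) (hS : IsK3Surface S) :
    2 * relEuler ℤ ℤ (Motives.ComplexPoints S) ∅ +
      3 * (6 - (Module.finrank ℂ (HodgeTheory.complexBetti S (2 * 1)) : ℤ)) = 0 := by
  obtain ⟨A, η, hη, hη0⟩ := hS.exists_holomorphicTwoForm_ne_zero
  have hX := hS.isSmoothProjective
  letI := hX.chartedSpace
  haveI := Motives.ComplexPoints.compactSpace_of_isSmoothProjective hX
  haveI := Motives.ComplexPoints.t2Space_of_isSmoothProjective hX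
  haveI := HodgeTheory.connectedSpace_complexPoints hX
  have hφ := A.isAnalytification
  haveI : CompactSpace A.carrier := A.compactSpace_carrier hX
  haveI : ConnectedSpace A.carrier :=
    hφ.homeomorph.symm.surjective.connectedSpace hφ.homeomorph.symm.continuous
  haveI : SecondCountableTopology A.carrier :=
    ChartedSpace.secondCountable_of_sigmaCompact A.model A.carrier
  have hfin : Module.finrank ℂ A.model = 2 := hφ.finrank_eq
  have hfinℝ : Module.finrank ℝ A.model = 4 := by rw [finrank_real_of_complex, hfin]
  let L : A.model ≃L[ℝ] EuclideanSpace ℝ (Fin 4) :=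
    ContinuousLinearEquiv.ofFinrankEq (by rw [hfinℝ, finrank_euclideanSpace_fin])
  haveI : CompactSpace (Recharted A.carrier L) := ‹CompactSpace A.carrier›
  obtain ⟨J, hJ⟩ := AlmostComplexStructure.exists_almostComplexStructure_recharted_of_complex
    (M := A.carrier) L ∞
  obtain ⟨μN, hμN⟩ := J.exists_isComplexOrientationOf_of_almostComplex
  have h := hHW (Recharted A.carrier L) J μN hμN
  rw [hS.firstChernClass_eq_zero A hη hη0 L J hJ, LinearMap.map_zero₂] at h
  have hsig := hS.signature_of_isComplexOrientationOf A hη hη0 L J hJ μN hμN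
  have hE : relEuler ℤ ℤ (Recharted A.carrier L) ∅ = relEuler ℤ ℤ (Motives.ComplexPoints S) ∅ :=
    relEuler_hodgeModel_carrier A
  change (0 : ℤ) = 2 * relEuler ℤ ℤ (Recharted A.carrier L) ∅ +
    3 * (intersectionForm two_add_two_eq_four μN).signature at h
  rw [hE, hsig] at h
  linarith

/-! ### Part 4: `b₂ = 22`, `e = 24`, index `−16` from the two named facts -/

/-- **`b₂ = 22` for a K3 surface from the Hirzebruch–Wu relation and `b₁ = 0`** — the named fact
`K3_finrank_complexBetti_two` from the two EXISTING named facts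
`hirzebruch_firstChernClass_sq_eq_almostComplex_four` (McDuff–Salamon (4.1.7)) and
`Huybrechts_K3_oddBetti_vanish` (`b₁ = b₃ = 0`): `0 = 2e + 3τ = 2(b₂ + 2) + 3(6 − b₂) = 22 − b₂`
(`IsK3Surface.two_mul_relEuler_add_three_mul_eq_zero`, `IsK3Surface.relEuler_eq_of_oddBetti`).
Huybrechts Ch. 1 §3.3 p. 24 reaches `b₂ = 22` through `e = c₂ = 24` (Noether); here the signature
theorem replaces Noether's formula. [cite: Huybrechts2016K3, Ch. 1 §3.3 p. 24 and Prop. 3.5, proof]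
[cite: McDuffSalamon2017, Rem. 4.1.10 (4.1.7)] -/
theorem K3_finrank_complexBetti_two_of_hirzebruch_of_oddBetti
    (hHW : hirzebruch_firstChernClass_sq_eq_almostComplex_four) (hodd : Huybrechts_K3_oddBetti_vanish) :
    K3_finrank_complexBetti_two := by
  intro S hS
  have h := hS.two_mul_relEuler_add_three_mul_eq_zero hHW
  rw [hS.relEuler_eq_of_oddBetti hodd] at h
  omega

/-- **`e(S(ℂ)) = 24` for a K3 surface** from the same two named facts (Huybrechts Ch. 1 §3.3 p. 24:
"`e(X) = c₂(X) = 24`"). [cite: Huybrechts2016K3, Ch. 1 §3.3 p. 24] -/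
theorem K3_relEuler_eq_of_hirzebruch_of_oddBetti
    (hHW : hirzebruch_firstChernClass_sq_eq_almostComplex_four) (hodd : Huybrechts_K3_oddBetti_vanish)
    (S : Motives.SchemeOver ℂ) (hS : IsK3Surface S) :
    relEuler ℤ ℤ (Motives.ComplexPoints S) ∅ = 24 := by
  rw [hS.relEuler_eq_of_oddBetti hodd, K3_finrank_complexBetti_two_of_hirzebruch_of_oddBetti hHW hodd S hS]
  norm_num

/-- **`K3_exists_orientation_signature_hodgeRiemann_ample` (index `−16`, Hodge–Riemann on
`H^{2,0}`, an ample class, for the complex orientation) from the two named facts**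
`hirzebruch_firstChernClass_sq_eq_almostComplex_four` and `Huybrechts_K3_oddBetti_vanish`:
through `b₂ = 22` (`K3_finrank_complexBetti_two_of_hirzebruch_of_oddBetti`) and
`K3_exists_orientation_signature_hodgeRiemann_ample_of_finrank_complexBetti_two`.
[cite: Huybrechts2016K3, Ch. 1 Prop. 3.5, proof (p. 24); Ch. 6 Prop. 1.2 (ii)]
[cite: MilnorStasheff1974, §19 Thm. 19.4] [cite: McDuffSalamon2017, Rem. 4.1.10 (4.1.7)] -/
theorem K3_exists_orientation_signature_hodgeRiemann_ample_of_hirzebruch_of_oddBetti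
    (hHW : hirzebruch_firstChernClass_sq_eq_almostComplex_four) (hodd : Huybrechts_K3_oddBetti_vanish) :
    K3_exists_orientation_signature_hodgeRiemann_ample :=
  K3_exists_orientation_signature_hodgeRiemann_ample_of_finrank_complexBetti_two
    (K3_finrank_complexBetti_two_of_hirzebruch_of_oddBetti hHW hodd)

end K3

end Literature.AlgebraicGeometry.Surfaces

end
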